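import Summits.Ventures.LatticeQCDFlow.Scaling.StarAdditiveDecay
import Summits.Ventures.LatticeQCDFlow.Scaling.StarPersistenceWeights

/-!
HONEST FRAMING: exact (Metropolis-corrected) sampling algorithms for lattice gauge theory; figures
of merit are autocorrelation/cost numbers at stated couplings and volumes; no continuum-physics
claim.

# StarSlowSwapLaw — OPEN-MATH ITEM 1 (i) AT SLOW-TO-MODERATE SWAPS FOR EVERY FINITE CONTENT TYPE: FOR THE HOMOGENEOUS `q`-CONTENT STAR WITH `4t ≤ h`
# (`h = (1−t)w_0`), `d(n) ≤ (eK/(p·W_lo) + 1)·e^{−hρn/4}` AND `t_mix(ε) ≤ ⌈(12K(t+h)/(p·h·t))·log((eK/(p·W_lo) + 1)/ε)⌉₊ ≤ ⌈(15K/(p·t))·log(…)⌉₊`,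
# `ρ = (t/(t+h))·(p/3)/K` — THE CONJECTURED ORDER `K/(p·min{t,h})` THERE (lean-2 GEN-34, ours)

Venture-side (OURS).  Cell `lqcd-flow` (pub-lqcd), unit `pub-lqcd-lean-2-g34`, 2026-08-29.  Chapter U, file 3 = files 1/1b (`StarAdditiveCertificate`, `StarAdditiveDecay`) on file 2
(`StarPersistenceWeights`).  THE MODEL (as in `StarLumpedBracket`): a persistent hub with exact redraws from `μ_0` (weight `w_0 > 0`), `K` idle cold levels of ONE law `μ_1` on a
finite content type `S` (all masses positive), identity maps, a uniform entry list (`c` entries per level), swap fraction `0 < t < 1`; `p > 0` a HUB-DOMINATION constant,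
`p·μ_1 ≤ μ_0` (chapter M's one-sided transported domination for identity maps); `W = μ_1/μ_0` the persistence weight and `W_lo > 0` any lower bound for `max{W(u), W(v)}` over
`u ≠ v` (e.g. the second-smallest value of `W`).  THE POTENTIAL: `Ψ(x,y) = Σ_{levels l, x_l ≠ y_l} max{W(x_l), W(y_l)}/W_lo` — each disagreeing cold level costs the persistence
of the more persistent of its two contents (memo-33 §5's reading of the Perron vector), no environment term, no hub term; hub-pair debt `E = cost/(1−2σ)`, `σ = t/(t+h)`.

## What is proved

* `slowSwap_certificate` — at `4t ≤ h` (`σ ≤ 1/5`, `λ = 1/(1−2σ) ≤ 5/3`, `σλ ≤ 1/3`) the data above satisfy every hypothesis of file 1 with `κ₀ = p/3`, `G_max = 1/(p·W_lo)`.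
* **`homStar_worstTvDist_le_slowSwap`** — `d(n) ≤ (e·K/(p·W_lo) + 1)·exp(−((1−t)w_0·ρ/4)·n)`, `ρ = (t/(t+(1−t)w_0))·(p/3)/K`;
  **`homStar_mixingTime_le_slowSwap`** — `t_mix(ε) ≤ ⌈(4/((1−t)w_0·ρ))·log((e·(K·(1/(p·W_lo))) + 1)/ε)⌉₊`.
* **`homStar_mixingTime_le_slowSwap'`** — the closed form `⌈(12K(t+h)/(p·h·t))·log((eK/(p·W_lo)+1)/ε)⌉₊`; **`homStar_mixingTime_le_slowSwap''`** —
  `⌈(15K/(p·t))·log((eK/(p·W_lo)+1)/ε)⌉₊`; **`fifthSwapStar_mixingTime_le`** — the card `t = 1/5`, `w_0 = 1`: `⌈(75K/p)·log((eK/(p·W_lo)+1)/ε)⌉₊`, the order `K/p` of OPEN-MATH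
  item 5 at a `p`-INDEPENDENT swap fraction, for EVERY number of contents `q = |S|`, every `K`, every pair of laws (the laws enter through `p` and, inside the logarithm, `W_lo`).

Reading (no numerics implied): for `q = 2` this is the `t ≲ h` half of T4 (`BooleanStarLawFreeOrder`) with `W_lo = W_max = 1/p` (`Ψ` = the disagreement count); for `q ≥ 3` it is the
first volume-free, regime-free law of the `q`-content star outside chapter M's `4t ≤ p·h`.  The regime `t ≫ h` (fast swaps) for `q ≥ 3` stays open: there the environment-free
potential fails (toy: `κ < 0` at `t = 4h` for some laws, `work-gen34/numerics/`) and an environment term in the conserved compositions is needed, as in chapter T.  NOT CLAIMED: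
anything measured.  Literature grade (cell rule): OWN; nothing cited as a fact; no new bib keys.
-/

noncomputable section
open Finset Function
open Literature.Probability.MarkovChains

namespace Summit.Ventures.LatticeQCDFlow.Scaling

/-! ## §1 The certificate data at slow swaps -/

section Cert
variable {S : Type*} [Fintype S] [DecidableEq S]

/-- **The slow-swap certificate:** for positive laws `μ_0, μ_1` on `S` with `p·μ_1 ≤ μ_0` (`p > 0`), `W_lo ≤ max{W(u),W(v)}` off the diagonal (`W = μ_1/μ_0`, `W_lo > 0`) and
`0 < σ ≤ 1/5`, the cost `G(u,v) = max{W(u),W(v)}/W_lo` (`u ≠ v`), the debt `E = G/(1−2σ)` and the acceptances `acc(x,u) = min{1, μ_0(u)μ_1(x)/(μ_0(x)μ_1(u))}` satisfy (N), (D), (R)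
of `StarAdditiveCertificate` with `κ₀ = p/3`, together with `G(s,s) = 0`, `1 ≤ G ≤ 1/(p·W_lo)` off the diagonal, `E ≥ 0`. [ours] -/
theorem slowSwap_certificate {μ0 μ1 : S → ℝ} (hμ0 : ∀ u, 0 < μ0 u) (hμ1p : ∀ u, 0 < μ1 u) (hμ1s : ∑ u, μ1 u = 1)
    {p : ℝ} (hp0 : 0 < p) (hp : ∀ u, p * μ1 u ≤ μ0 u)
    {Wlo : ℝ} (hWlo0 : 0 < Wlo) (hWlo : ∀ u v, u ≠ v → Wlo ≤ max (μ1 u / μ0 u) (μ1 v / μ0 v))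
    {σ : ℝ} (hσ0 : 0 < σ) (hσ5 : σ ≤ 1 / 5)
    {acc G E : S → S → ℝ} (hacc : ∀ u v, acc u v = min 1 (μ0 v * μ1 u / (μ0 u * μ1 v)))
    (hG : ∀ u v, G u v = if u = v then 0 else 1 / Wlo * max (μ1 u / μ0 u) (μ1 v / μ0 v)) (hE : ∀ u v, E u v = 1 / (1 - 2 * σ) * G u v)
    {net : S → S → S → ℝ}
    (hnet : ∀ z u v, net z u v = min (acc z u) (acc z v) * (G u v - σ * E u v)
      - (acc z u - min (acc z u) (acc z v)) * (G z v - G u v + σ * E u z) - (acc z v - min (acc z u) (acc z v)) * (G u z - G u v + σ * E z v)) :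
    (∀ s, G s s = 0) ∧ (∀ u v, u ≠ v → 1 ≤ G u v) ∧ (∀ u v, 0 ≤ G u v) ∧ (∀ u v, G u v ≤ 1 / (p * Wlo)) ∧ (∀ u v, 0 ≤ E u v)
      ∧ (∀ z u v, 0 ≤ net z u v)
      ∧ (∀ a b s t, a ≠ b →
          min (acc a s) (acc b t) * (G a b - G s t + σ * E s t) + (acc a s - min (acc a s) (acc b t)) * (G a t - G s t + σ * E s b)
            + (acc b t - min (acc a s) (acc b t)) * (G s b - G s t + σ * E a t) + (1 - acc a s - acc b t + min (acc a s) (acc b t)) * (σ * E a b) ≤ E a b)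
      ∧ (∀ u v, p / 3 * G u v ≤ ∑ z, μ0 z * net z u v) := by
  -- the persistence weight and the constants
  set W : S → ℝ := fun u => μ1 u / μ0 u with hWdef
  have hW : ∀ u, 0 < W u := fun u => div_pos (hμ1p u) (hμ0 u)
  have hWp : ∀ u, p * W u ≤ 1 := fun u => by
    show p * (μ1 u / μ0 u) ≤ 1
    rw [mul_div_assoc', div_le_one (hμ0 u)]; exact hp u
  set lam : ℝ := 1 / (1 - 2 * σ) with hlamdef
  have h12 : 0 < 1 - 2 * σ := by linarith
  have hlam0 : 0 ≤ lam := div_nonneg zero_le_one h12.le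
  have hlam : lam = 1 + 2 * (σ * lam) := by rw [hlamdef]; field_simp; ring
  have hσl : σ * lam ≤ 1 / 3 := by rw [hlamdef, mul_one_div, div_le_iff₀ h12]; linarith
  set γ : ℝ := 1 / Wlo with hγdef
  have hγ : 0 < γ := div_pos one_pos hWlo0
  have hacc' : ∀ x u, acc x u = min 1 (W x / W u) := fun x u => by
    rw [hacc]
    congr 1
    show μ0 u * μ1 x / (μ0 x * μ1 u) = μ1 x / μ0 x / (μ1 u / μ0 u)
    have := hμ0 u; have := hμ0 x; have := hμ1p u
    field_simp
  have hG' : ∀ u v, G u v = if u = v then 0 else γ * max (W u) (W v) := fun u v => by rw [hG]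
  have hE' : ∀ u v, E u v = lam * G u v := fun u v => by rw [hE]
  obtain ⟨hG0, hGd, _, hGne, hGle⟩ := persist_cost_basic hW hγ hG'
  refine ⟨hGd, fun u v huv => ?_, hG0, fun u v => ?_, fun u v => by rw [hE']; exact mul_nonneg hlam0 (hG0 u v), fun z u v => ?_,
    fun a b s t hab => persist_debt_le hW hacc' hγ hG' hE' hσ0.le hlam0 hlam (by linarith) hab s t, fun u v => ?_⟩
  · -- `1 ≤ G(u,v)` off the diagonal: `max W ≥ W_lo = 1/γ`
    rw [hGne u v huv, hγdef, one_div_mul_eq_div, one_le_div hWlo0]; exact hWlo u v huv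
  · -- `G ≤ γ·W_max ≤ 1/(p·W_lo)`
    refine (hGle u v).trans ?_
    have hmax : max (W u) (W v) ≤ 1 / p := by
      rw [max_le_iff, le_div_iff₀ hp0, le_div_iff₀ hp0]; constructor <;> nlinarith [hWp u, hWp v]
    calc γ * max (W u) (W v) ≤ 1 / Wlo * (1 / p) := mul_le_mul_of_nonneg_left hmax hγ.le
      _ = 1 / (p * Wlo) := by field_simp
  · -- (N)
    have h := persist_net_ge hW hacc' hγ hG' hE' hσ0.le hlam0 hnet z u v
    have : 0 ≤ (1 - 2 * (σ * lam)) * G u v * min (acc z u) (acc z v) :=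
      mul_nonneg (mul_nonneg (by linarith) (hG0 u v)) (le_min (persist_acc_mem hW hacc' z u).1 (persist_acc_mem hW hacc' z v).1)
    linarith
  · -- (R) with `κ₀ = p/3 ≤ p(1 − 2σλ)`
    have h := persist_redraw_ge hW hacc' hγ hG' hE' hσ0.le hlam0 (by linarith) hnet (μ0 := μ0) (μ1 := μ1) (p := p)
      (fun z => (hμ0 z).le) (fun z => by show μ0 z * (μ1 z / μ0 z) = μ1 z; field_simp [(hμ0 z).ne']) hμ1s hWp u v
    have : p / 3 * G u v ≤ (1 - 2 * (σ * lam)) * p * G u v := by nlinarith [hG0 u v, mul_nonneg hp0.le (hG0 u v)]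
    linarith

end Cert

/-! ## §2 The laws -/

section Law
variable {K m : ℕ} {S : Type*} [Fintype S] [DecidableEq S] {μ : Fin (K + 1) → S → ℝ}
variable (κ : Fin m → Fin K)
variable {M : Fin (K + 1) → S → S → ℝ} {w : Fin (K + 1) → ℝ} {t : ℝ}

/-- **THE DISTANCE PROFILE AT SLOW SWAPS, EVERY FINITE CONTENT TYPE.**  Homogeneous `q`-content star (persistent hub with exact redraws of weight `w_0 > 0`, `K` idle cold
levels of one law `μ_1`, identity maps, uniform entry list, `0 < t < 1`), hub domination `p·μ_1 ≤ μ_0` (`p > 0`), `W_lo ≤ max{W(u),W(v)}` for `u ≠ v` (`W = μ_1/μ_0`, `W_lo > 0`),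
and SLOW SWAPS `4t ≤ (1−t)w_0`: **`d(n) ≤ (e·(K·(1/(p·W_lo))) + 1)·exp(−((1−t)w_0·ρ/4)·n)`, `ρ = (t/(t + (1−t)w_0))·(p/3)/K`**. [ours] -/
theorem homStar_worstTvDist_le_slowSwap [Nonempty S] (hm : 1 ≤ m) (ht0 : 0 < t) (ht1 : t < 1) (hw0 : ∀ k, 0 ≤ w k) (hw00 : 0 < w 0)
    (hw1 : ∑ k, w k = 1) (hμ : ∀ k x, 0 < μ k x) (hμ1 : ∀ k, ∑ u, μ k u = 1) (hM0 : ∀ u v, M 0 u v = μ 0 v)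
    (hidle : ∀ i : Fin K, ∀ u v, M i.succ u v = if v = u then 1 else 0) (hhom : ∀ i : Fin K, μ i.succ = μ 1)
    {c : ℕ} (hunif : ∀ i : Fin K, (univ.filter fun r : Fin m => κ r = i).card = c)
    {p : ℝ} (hp0 : 0 < p) (hp : ∀ u, p * μ 1 u ≤ μ 0 u)
    {Wlo : ℝ} (hWlo0 : 0 < Wlo) (hWlo : ∀ u v, u ≠ v → Wlo ≤ max (μ 1 u / μ 0 u) (μ 1 v / μ 0 v))
    (hslow : 4 * t ≤ (1 - t) * w 0) (n : ℕ) :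
    worstTvDist (fun y z : Fin (K + 1) → S =>
        t * ptGraphSwap μ (fun r : Fin m => (((0 : Fin (K + 1)), (κ r).succ) : Fin (K + 1) × Fin (K + 1))) (fun _ : Fin m => Equiv.refl S) y z
          + (1 - t) * prodKernel w M y z) (tensorFun μ) n
      ≤ (Real.exp 1 * (K * (1 / (p * Wlo))) + 1) * Real.exp (-((1 - t) * w 0 * (t / (t + (1 - t) * w 0) * (p / 3) / K) / 4) * n) := by
  classical
  have hh0 : 0 < (1 - t) * w 0 := mul_pos (by linarith) hw00
  have hσ0 : 0 < t / (t + (1 - t) * w 0) := div_pos ht0 (by linarith)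
  have hσ5 : t / (t + (1 - t) * w 0) ≤ 1 / 5 := by rw [div_le_iff₀ (by linarith)]; linarith
  let acc : S → S → ℝ := fun u v => min 1 (μ 0 v * μ 1 u / (μ 0 u * μ 1 v))
  let cnt : (Fin (K + 1) → S) × (Fin (K + 1) → S) → S → S → ℝ := fun a s t' =>
    ((univ.filter fun i : Fin K => a.1 i.succ = s ∧ a.2 i.succ = t').card : ℝ)
  let G : S → S → ℝ := fun u v => if u = v then 0 else 1 / Wlo * max (μ 1 u / μ 0 u) (μ 1 v / μ 0 v)
  let E : S → S → ℝ := fun u v => 1 / (1 - 2 * (t / (t + (1 - t) * w 0))) * G u v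
  let net : S → S → S → ℝ := fun z u v => min (acc z u) (acc z v) * (G u v - t / (t + (1 - t) * w 0) * E u v)
      - (acc z u - min (acc z u) (acc z v)) * (G z v - G u v + t / (t + (1 - t) * w 0) * E u z)
      - (acc z v - min (acc z u) (acc z v)) * (G u z - G u v + t / (t + (1 - t) * w 0) * E z v)
  obtain ⟨hGd, hG1, hG0, hGmax, hE0, hN, hD, hR⟩ := slowSwap_certificate (fun u => hμ 0 u) (fun u => hμ 1 u) (hμ1 1) hp0 hp hWlo0 hWlo hσ0 hσ5
    (acc := acc) (G := G) (E := E) (fun u v => rfl) (fun u v => rfl) (fun u v => rfl) (net := net) (fun z u v => rfl)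
  have hp1 : p ≤ 1 := by
    have h := Finset.sum_le_sum fun u (_ : u ∈ (univ : Finset S)) => hp u
    rw [← Finset.mul_sum, hμ1 1, hμ1 0, mul_one] at h; exact h
  exact homStar_worstTvDist_le_of_additiveCertificate κ hm ht0 ht1 hw0 hw00 hw1 hμ hμ1 hM0 hidle hhom hunif (acc := acc) (fun u v => rfl) (cnt := cnt)
    (fun a s t' => rfl) hGd hG1 hG0 hGmax hE0 rfl (net := net) (fun z u v => rfl) hN hD hR (by positivity) (by linarith) n

/-- **OPEN-MATH ITEM 1 (i) AT SLOW-TO-MODERATE SWAPS, EVERY FINITE CONTENT TYPE** — the mixing time: same hypotheses,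
**`t_mix(ε) ≤ ⌈(4/((1−t)w_0·ρ))·log((e·(K·(1/(p·W_lo))) + 1)/ε)⌉₊`, `ρ = (t/(t + (1−t)w_0))·(p/3)/K`**. [ours] -/
theorem homStar_mixingTime_le_slowSwap [Nonempty S] (hm : 1 ≤ m) (ht0 : 0 < t) (ht1 : t < 1) (hw0 : ∀ k, 0 ≤ w k) (hw00 : 0 < w 0)
    (hw1 : ∑ k, w k = 1) (hμ : ∀ k x, 0 < μ k x) (hμ1 : ∀ k, ∑ u, μ k u = 1) (hM0 : ∀ u v, M 0 u v = μ 0 v)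
    (hidle : ∀ i : Fin K, ∀ u v, M i.succ u v = if v = u then 1 else 0) (hhom : ∀ i : Fin K, μ i.succ = μ 1)
    {c : ℕ} (hunif : ∀ i : Fin K, (univ.filter fun r : Fin m => κ r = i).card = c)
    {p : ℝ} (hp0 : 0 < p) (hp : ∀ u, p * μ 1 u ≤ μ 0 u)
    {Wlo : ℝ} (hWlo0 : 0 < Wlo) (hWlo : ∀ u v, u ≠ v → Wlo ≤ max (μ 1 u / μ 0 u) (μ 1 v / μ 0 v))
    (hslow : 4 * t ≤ (1 - t) * w 0) {ε : ℝ} (hε : 0 < ε) :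
    mixingTime (fun y z : Fin (K + 1) → S =>
        t * ptGraphSwap μ (fun r : Fin m => (((0 : Fin (K + 1)), (κ r).succ) : Fin (K + 1) × Fin (K + 1))) (fun _ : Fin m => Equiv.refl S) y z
          + (1 - t) * prodKernel w M y z) (tensorFun μ) ε
      ≤ ⌈1 / ((1 - t) * w 0 * (t / (t + (1 - t) * w 0) * (p / 3) / K) / 4) * Real.log ((Real.exp 1 * (K * (1 / (p * Wlo))) + 1) / ε)⌉₊ := by
  classical
  have hh0 : 0 < (1 - t) * w 0 := mul_pos (by linarith) hw00
  have hσ0 : 0 < t / (t + (1 - t) * w 0) := div_pos ht0 (by linarith)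
  have hσ5 : t / (t + (1 - t) * w 0) ≤ 1 / 5 := by rw [div_le_iff₀ (by linarith)]; linarith
  let acc : S → S → ℝ := fun u v => min 1 (μ 0 v * μ 1 u / (μ 0 u * μ 1 v))
  let cnt : (Fin (K + 1) → S) × (Fin (K + 1) → S) → S → S → ℝ := fun a s t' =>
    ((univ.filter fun i : Fin K => a.1 i.succ = s ∧ a.2 i.succ = t').card : ℝ)
  let G : S → S → ℝ := fun u v => if u = v then 0 else 1 / Wlo * max (μ 1 u / μ 0 u) (μ 1 v / μ 0 v)
  let E : S → S → ℝ := fun u v => 1 / (1 - 2 * (t / (t + (1 - t) * w 0))) * G u v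
  let net : S → S → S → ℝ := fun z u v => min (acc z u) (acc z v) * (G u v - t / (t + (1 - t) * w 0) * E u v)
      - (acc z u - min (acc z u) (acc z v)) * (G z v - G u v + t / (t + (1 - t) * w 0) * E u z)
      - (acc z v - min (acc z u) (acc z v)) * (G u z - G u v + t / (t + (1 - t) * w 0) * E z v)
  obtain ⟨hGd, hG1, hG0, hGmax, hE0, hN, hD, hR⟩ := slowSwap_certificate (fun u => hμ 0 u) (fun u => hμ 1 u) (hμ1 1) hp0 hp hWlo0 hWlo hσ0 hσ5
    (acc := acc) (G := G) (E := E) (fun u v => rfl) (fun u v => rfl) (fun u v => rfl) (net := net) (fun z u v => rfl)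
  have hp1 : p ≤ 1 := by
    have h := Finset.sum_le_sum fun u (_ : u ∈ (univ : Finset S)) => hp u
    rw [← Finset.mul_sum, hμ1 1, hμ1 0, mul_one] at h; exact h
  exact homStar_mixingTime_le_of_additiveCertificate κ hm ht0 ht1 hw0 hw00 hw1 hμ hμ1 hM0 hidle hhom hunif (acc := acc) (fun u v => rfl) (cnt := cnt)
    (fun a s t' => rfl) hGd hG1 hG0 hGmax hE0 rfl (net := net) (fun z u v => rfl) hN hD hR (by positivity) (by linarith) hε

/-- **THE CLOSED FORM: `t_mix(ε) ≤ ⌈(12K(t+h)/(p·h·t))·log((eK/(p·W_lo) + 1)/ε)⌉₊`**, `h = (1−t)w_0`, under `4t ≤ h`. [ours] -/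
theorem homStar_mixingTime_le_slowSwap' [Nonempty S] (hm : 1 ≤ m) (ht0 : 0 < t) (ht1 : t < 1) (hw0 : ∀ k, 0 ≤ w k) (hw00 : 0 < w 0)
    (hw1 : ∑ k, w k = 1) (hμ : ∀ k x, 0 < μ k x) (hμ1 : ∀ k, ∑ u, μ k u = 1) (hM0 : ∀ u v, M 0 u v = μ 0 v)
    (hidle : ∀ i : Fin K, ∀ u v, M i.succ u v = if v = u then 1 else 0) (hhom : ∀ i : Fin K, μ i.succ = μ 1)
    {c : ℕ} (hunif : ∀ i : Fin K, (univ.filter fun r : Fin m => κ r = i).card = c)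
    {p : ℝ} (hp0 : 0 < p) (hp : ∀ u, p * μ 1 u ≤ μ 0 u)
    {Wlo : ℝ} (hWlo0 : 0 < Wlo) (hWlo : ∀ u v, u ≠ v → Wlo ≤ max (μ 1 u / μ 0 u) (μ 1 v / μ 0 v))
    (hslow : 4 * t ≤ (1 - t) * w 0) {ε : ℝ} (hε : 0 < ε) :
    mixingTime (fun y z : Fin (K + 1) → S =>
        t * ptGraphSwap μ (fun r : Fin m => (((0 : Fin (K + 1)), (κ r).succ) : Fin (K + 1) × Fin (K + 1))) (fun _ : Fin m => Equiv.refl S) y z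
          + (1 - t) * prodKernel w M y z) (tensorFun μ) ε
      ≤ ⌈12 * K * (t + (1 - t) * w 0) / (p * ((1 - t) * w 0) * t) * Real.log ((Real.exp 1 * K / (p * Wlo) + 1) / ε)⌉₊ := by
  have main := homStar_mixingTime_le_slowSwap κ hm ht0 ht1 hw0 hw00 hw1 hμ hμ1 hM0 hidle hhom hunif hp0 hp hWlo0 hWlo hslow hε
  have hmK : (m : ℝ) = c * K := uniformList_card κ hunif
  have hK0 : (K : ℝ) ≠ 0 := by
    intro h0
    have : (m : ℝ) = 0 := by rw [hmK, h0]; simp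
    exact absurd (by exact_mod_cast this : m = 0) (by omega)
  have hh0 : (1 - t) * w 0 ≠ 0 := (mul_pos (by linarith) hw00).ne'
  have hth : t + (1 - t) * w 0 ≠ 0 := by have := mul_pos (show (0:ℝ) < 1 - t by linarith) hw00; linarith
  have e : 1 / ((1 - t) * w 0 * (t / (t + (1 - t) * w 0) * (p / 3) / K) / 4) = 12 * K * (t + (1 - t) * w 0) / (p * ((1 - t) * w 0) * t) := by
    field_simp
    ring
  have e2 : Real.exp 1 * (K * (1 / (p * Wlo))) = Real.exp 1 * K / (p * Wlo) := by
    field_simp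
  rw [e, e2] at main
  exact main

/-- **`t_mix(ε) ≤ ⌈(15K/(p·t))·log((eK/(p·W_lo) + 1)/ε)⌉₊` under `4t ≤ (1−t)w_0`** — `O((K/(p·t))·log(K/(p·W_lo·ε)))`: the conjectured law-free order `K/(p·min{t,h})` of OPEN-MATH
item 1 in the slow-swap regime, for every finite content type. [ours] -/
theorem homStar_mixingTime_le_slowSwap'' [Nonempty S] (hm : 1 ≤ m) (ht0 : 0 < t) (ht1 : t < 1) (hw0 : ∀ k, 0 ≤ w k) (hw00 : 0 < w 0)
    (hw1 : ∑ k, w k = 1) (hμ : ∀ k x, 0 < μ k x) (hμ1 : ∀ k, ∑ u, μ k u = 1) (hM0 : ∀ u v, M 0 u v = μ 0 v)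
    (hidle : ∀ i : Fin K, ∀ u v, M i.succ u v = if v = u then 1 else 0) (hhom : ∀ i : Fin K, μ i.succ = μ 1)
    {c : ℕ} (hunif : ∀ i : Fin K, (univ.filter fun r : Fin m => κ r = i).card = c)
    {p : ℝ} (hp0 : 0 < p) (hp : ∀ u, p * μ 1 u ≤ μ 0 u)
    {Wlo : ℝ} (hWlo0 : 0 < Wlo) (hWlo : ∀ u v, u ≠ v → Wlo ≤ max (μ 1 u / μ 0 u) (μ 1 v / μ 0 v))
    (hslow : 4 * t ≤ (1 - t) * w 0) {ε : ℝ} (hε : 0 < ε) :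
    mixingTime (fun y z : Fin (K + 1) → S =>
        t * ptGraphSwap μ (fun r : Fin m => (((0 : Fin (K + 1)), (κ r).succ) : Fin (K + 1) × Fin (K + 1))) (fun _ : Fin m => Equiv.refl S) y z
          + (1 - t) * prodKernel w M y z) (tensorFun μ) ε
      ≤ ⌈15 * K / (p * t) * Real.log ((Real.exp 1 * K / (p * Wlo) + 1) / ε)⌉₊ := by
  refine (homStar_mixingTime_le_slowSwap' κ hm ht0 ht1 hw0 hw00 hw1 hμ hμ1 hM0 hidle hhom hunif hp0 hp hWlo0 hWlo hslow hε).trans ?_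
  -- `12K(t+h)/(p h t) ≤ 15K/(p t)` since `t + h ≤ (5/4)h`; then `⌈a·L⌉₊ ≤ ⌈b·L⌉₊` for `0 ≤ a ≤ b` and any sign of `L`
  have hh0 : 0 < (1 - t) * w 0 := mul_pos (by linarith) hw00
  have hab : 12 * K * (t + (1 - t) * w 0) / (p * ((1 - t) * w 0) * t) ≤ 15 * K / (p * t) := by
    rw [div_le_div_iff₀ (by positivity) (by positivity)]
    have hK : (0 : ℝ) ≤ K := Nat.cast_nonneg K
    nlinarith [mul_nonneg (mul_nonneg hK hp0.le) ht0.le, mul_nonneg (mul_nonneg (mul_nonneg hK hp0.le) ht0.le) hh0.le,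
      mul_nonneg (mul_nonneg (mul_nonneg hK hp0.le) ht0.le) (show (0:ℝ) ≤ (1 - t) * w 0 - 4 * t by linarith)]
  have ha : 0 ≤ 12 * K * (t + (1 - t) * w 0) / (p * ((1 - t) * w 0) * t) := by positivity
  rcases le_or_gt 0 (Real.log ((Real.exp 1 * K / (p * Wlo) + 1) / ε)) with hL | hL
  · exact Nat.ceil_mono (mul_le_mul_of_nonneg_right hab hL)
  · rw [Nat.ceil_eq_zero.mpr (by nlinarith)]; exact Nat.zero_le _

/-- **THE FIFTH-SWAP CARD, EVERY LAW AND EVERY `q`: `t_mix(ε) ≤ ⌈(75·K/p)·log((eK/(p·W_lo)+1)/ε)⌉₊`** for the homogeneous `q`-content star at swap fraction `t = 1/5` with `w_0 = 1`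
(the hub is redrawn at every non-swap step, `h = 4/5 = 4t`) — the order `K/p` of OPEN-MATH item 5 at a `p`-INDEPENDENT swap fraction. [ours] -/
theorem fifthSwapStar_mixingTime_le [Nonempty S] (hm : 1 ≤ m) (hw0 : ∀ k, 0 ≤ w k) (hw01 : w 0 = 1)
    (hw1 : ∑ k, w k = 1) (hμ : ∀ k x, 0 < μ k x) (hμ1 : ∀ k, ∑ u, μ k u = 1) (hM0 : ∀ u v, M 0 u v = μ 0 v)
    (hidle : ∀ i : Fin K, ∀ u v, M i.succ u v = if v = u then 1 else 0) (hhom : ∀ i : Fin K, μ i.succ = μ 1)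
    {c : ℕ} (hunif : ∀ i : Fin K, (univ.filter fun r : Fin m => κ r = i).card = c)
    {p : ℝ} (hp0 : 0 < p) (hp : ∀ u, p * μ 1 u ≤ μ 0 u)
    {Wlo : ℝ} (hWlo0 : 0 < Wlo) (hWlo : ∀ u v, u ≠ v → Wlo ≤ max (μ 1 u / μ 0 u) (μ 1 v / μ 0 v)) {ε : ℝ} (hε : 0 < ε) :
    mixingTime (fun y z : Fin (K + 1) → S =>
        (1 / 5 : ℝ) * ptGraphSwap μ (fun r : Fin m => (((0 : Fin (K + 1)), (κ r).succ) : Fin (K + 1) × Fin (K + 1))) (fun _ : Fin m => Equiv.refl S) y z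
          + (1 - 1 / 5) * prodKernel w M y z) (tensorFun μ) ε
      ≤ ⌈75 * K / p * Real.log ((Real.exp 1 * K / (p * Wlo) + 1) / ε)⌉₊ := by
  have h := homStar_mixingTime_le_slowSwap'' κ (t := 1 / 5) hm (by norm_num) (by norm_num) hw0 (by rw [hw01]; norm_num) hw1 hμ hμ1 hM0 hidle hhom hunif
    hp0 hp hWlo0 hWlo (by rw [hw01]; norm_num) hε
  have e : (15 : ℝ) * K / (p * (1 / 5)) = 75 * K / p := by field_simp; ring
  rw [e] at h
  exact h

end Law

end Summit.Ventures.LatticeQCDFlow.Scaling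

end
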